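import Summits.Ventures.HodgeRepro2.T5SU11SphericalCfunLimit

/-!
# Log-convexity of `λ ↦ φ_λ(g)` on `SU(1,1)` (Hölder), and the monotonicity in the parameter:
`φ_λ(g)` is non-increasing on `λ ≤ 1`, non-decreasing on `λ ≥ 1`, and a function of `|λ - 1|`

The midpoint log-convexity `sph((λ₁+λ₂)/2)² ≤ sph λ₁ · sph λ₂` of `T5SU11SphericalBounds` was
Cauchy–Schwarz on `(K, dk)`; with Hölder's inequality for the conjugate exponents `1/a`, `1/b`
(`a + b = 1`, `Real.holderConjugate_one_div`, `integral_mul_le_Lp_mul_Lq_of_nonneg`) it becomes the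
full **log-convexity** `sph (a λ₁ + b λ₂) g ≤ sph λ₁ g ^ a · sph λ₂ g ^ b` (`sph_hyp_combination_le`,
`sph_combination_le`), i.e. `λ ↦ log (sph λ g)` is convex on `ℝ` (`convexOn_log_sph`). Combined with
the functional equation `sph λ = sph (2 - λ)` (`T5SU11SphericalSymmetry.sph_two_sub`) — a convex
function symmetric about `λ = 1` — this gives the monotonicity: **`sph λ₂ g ≤ sph λ₁ g` for
`λ₁ ≤ λ₂ ≤ 1`** (`sph_anti_of_le_one`: write `λ₂ = (1 - s) λ₁ + s (2 - λ₁)` with `s ∈ (0, 1)`),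
**`sph λ₁ g ≤ sph λ₂ g` for `1 ≤ λ₁ ≤ λ₂`** (`sph_mono_of_one_le`), `AntitoneOn` / `MonotoneOn`
statements (`antitoneOn_sph`, `monotoneOn_sph`), `sph λ g = sph (1 - |λ - 1|) g`
(`sph_eq_sph_one_sub_abs`) and **`|λ - 1| ≤ |λ' - 1| → sph λ g ≤ sph λ' g`** (`sph_le_of_abs_sub_one_le`):
every real spherical function is a non-decreasing function of the distance `|λ - ρ|` to the critical
parameter, with Harish-Chandra's `Ξ = φ₁` at the bottom (`T5SU11SphericalBounds.sph_one_le`). Nothing is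
claimed about (N).

Blind lane: Mathlib + the HodgeRepro2 prefix only; no sorry; axioms ⊆ {propext, Classical.choice,
Quot.sound}.
-/

namespace Summit.Ventures.HodgeRepro2.T5SU11SphericalLogConvex

open MeasureTheory Metric Set Filter Topology Complex
open T5SU11Unimodular T5SU11Fibration T5SU11Cartan T5SU11OneParameter T5SU11CartanProjection
  T5HaarCircle T5BergmanCoefficient T5SU11SphericalFunction T5SU11SphericalTwo
  T5SU11SphericalSymmetry T5SU11SphericalBounds T5SU11SphericalContinuous
  T5SU11SphericalAsymptotic T5SU11SphericalLp T5SU11SphericalCfun T5SU11SphericalLpSharp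
  T5SU11SphericalXiLog T5SU11SphericalCfunLimit
open scoped Real

section measure

variable [MeasurableSpace Circle] [BorelSpace Circle]

/-- **Hölder on `(K, dk)`**: `sph (a λ₁ + b λ₂) (a_t) ≤ sph λ₁ (a_t) ^ a · sph λ₂ (a_t) ^ b` for
`a, b > 0`, `a + b = 1`. -/
theorem sph_hyp_combination_le {a b : ℝ} (ha : 0 < a) (hb : 0 < b) (hab : a + b = 1)
    (l₁ l₂ t : ℝ) :
    sph (a * l₁ + b * l₂) (hyp t) ≤ sph l₁ (hyp t) ^ a * sph l₂ (hyp t) ^ b := by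
  rw [sph_hyp, sph_hyp, sph_hyp]
  have hH := integral_mul_le_Lp_mul_Lq_of_nonneg (μ := haarCircle)
    (Real.holderConjugate_one_div ha hb hab)
    (f := fun u : Circle =>
      ‖(Real.cosh t : ℂ) - (starRingEnd ℂ) (u : ℂ) ^ 2 * Real.sinh t‖ ^ (-(a * l₁)))
    (g := fun u : Circle =>
      ‖(Real.cosh t : ℂ) - (starRingEnd ℂ) (u : ℂ) ^ 2 * Real.sinh t‖ ^ (-(b * l₂)))
    (Filter.Eventually.of_forall fun u => Real.rpow_nonneg (norm_nonneg _) _)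
    (Filter.Eventually.of_forall fun u => Real.rpow_nonneg (norm_nonneg _) _)
    (memLp_kint_rpow t _ _) (memLp_kint_rpow t _ _)
  have e1 : ∀ u : Circle,
      ‖(Real.cosh t : ℂ) - (starRingEnd ℂ) (u : ℂ) ^ 2 * Real.sinh t‖ ^ (-(a * l₁)) *
        ‖(Real.cosh t : ℂ) - (starRingEnd ℂ) (u : ℂ) ^ 2 * Real.sinh t‖ ^ (-(b * l₂)) =
      ‖(Real.cosh t : ℂ) - (starRingEnd ℂ) (u : ℂ) ^ 2 * Real.sinh t‖ ^ (-(a * l₁ + b * l₂)) :=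
    fun u => by
      rw [← Real.rpow_add (kint_pos t u)]
      congr 1
      ring
  have e2 : ∀ u : Circle,
      (‖(Real.cosh t : ℂ) - (starRingEnd ℂ) (u : ℂ) ^ 2 * Real.sinh t‖ ^ (-(a * l₁))) ^ (1 / a) =
      ‖(Real.cosh t : ℂ) - (starRingEnd ℂ) (u : ℂ) ^ 2 * Real.sinh t‖ ^ (-l₁) := fun u => by
    rw [← Real.rpow_mul (kint_pos t u).le, mul_one_div, neg_div, mul_div_cancel_left₀ _ ha.ne']
  have e3 : ∀ u : Circle,
      (‖(Real.cosh t : ℂ) - (starRingEnd ℂ) (u : ℂ) ^ 2 * Real.sinh t‖ ^ (-(b * l₂))) ^ (1 / b) =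
      ‖(Real.cosh t : ℂ) - (starRingEnd ℂ) (u : ℂ) ^ 2 * Real.sinh t‖ ^ (-l₂) := fun u => by
    rw [← Real.rpow_mul (kint_pos t u).le, mul_one_div, neg_div, mul_div_cancel_left₀ _ hb.ne']
  simp_rw [e1, e2, e3, one_div_one_div] at hH
  exact hH

/-- **Log-convexity in the parameter (Hölder)**: `sph (a λ₁ + b λ₂) g ≤ sph λ₁ g ^ a · sph λ₂ g ^ b`
for `a, b > 0`, `a + b = 1`, on the whole group. -/
theorem sph_combination_le {a b : ℝ} (ha : 0 < a) (hb : 0 < b) (hab : a + b = 1) (l₁ l₂ : ℝ)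
    (g : SU11) : sph (a * l₁ + b * l₂) g ≤ sph l₁ g ^ a * sph l₂ g ^ b := by
  rw [sph_eq_sph_hyp_cartanT (a * l₁ + b * l₂) g, sph_eq_sph_hyp_cartanT l₁ g,
    sph_eq_sph_hyp_cartanT l₂ g]
  exact sph_hyp_combination_le ha hb hab l₁ l₂ _

/-- **`λ ↦ log (sph λ g)` is convex on `ℝ`.** -/
theorem convexOn_log_sph (g : SU11) : ConvexOn ℝ Set.univ fun lam : ℝ => Real.log (sph lam g) := by
  refine ⟨convex_univ, fun x _ y _ a b ha hb hab => ?_⟩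
  simp only [smul_eq_mul]
  rcases eq_or_lt_of_le ha with ha' | ha'
  · have hb1 : b = 1 := by linarith
    subst hb1
    rw [← ha']
    simp
  rcases eq_or_lt_of_le hb with hb' | hb'
  · have ha1 : a = 1 := by linarith
    subst ha1
    rw [← hb']
    simp
  have h := sph_combination_le ha' hb' hab x y g
  calc Real.log (sph (a * x + b * y) g) ≤ Real.log (sph x g ^ a * sph y g ^ b) :=
        Real.log_le_log (sph_pos _ _) h
    _ = a * Real.log (sph x g) + b * Real.log (sph y g) := by
        rw [Real.log_mul (Real.rpow_pos_of_pos (sph_pos _ _) _).ne'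
          (Real.rpow_pos_of_pos (sph_pos _ _) _).ne', Real.log_rpow (sph_pos _ _),
          Real.log_rpow (sph_pos _ _)]

/-- **Non-increasing on `λ ≤ 1`**: `sph λ₂ g ≤ sph λ₁ g` for `λ₁ ≤ λ₂ ≤ 1`. -/
theorem sph_anti_of_le_one {l₁ l₂ : ℝ} (h : l₁ ≤ l₂) (h1 : l₂ ≤ 1) (g : SU11) :
    sph l₂ g ≤ sph l₁ g := by
  rcases h.lt_or_eq with hlt | rfl
  · have h1' : l₁ < 1 := lt_of_lt_of_le hlt h1
    set s : ℝ := (l₂ - l₁) / (2 * (1 - l₁)) with hs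
    have hs0 : 0 < s := by
      rw [hs]
      exact div_pos (by linarith) (by linarith)
    have hs1 : s < 1 := by
      rw [hs, div_lt_one (by linarith)]
      linarith
    have hsmul : s * (2 * (1 - l₁)) = l₂ - l₁ := by
      rw [hs]
      exact div_mul_cancel₀ _ (by linarith : (2 * (1 - l₁) : ℝ) ≠ 0)
    have hab : (1 - s) + s = 1 := by ring
    have hl : l₂ = (1 - s) * l₁ + s * (2 - l₁) := by linear_combination (-1 : ℝ) * hsmul
    have key := sph_combination_le (by linarith) hs0 hab l₁ (2 - l₁) g
    rw [← hl, ← sph_two_sub l₁ g] at key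
    calc sph l₂ g ≤ sph l₁ g ^ (1 - s) * sph l₁ g ^ s := key
      _ = sph l₁ g := by rw [← Real.rpow_add (sph_pos _ _), hab, Real.rpow_one]
  · exact le_refl _

/-- **Non-decreasing on `λ ≥ 1`**: `sph λ₁ g ≤ sph λ₂ g` for `1 ≤ λ₁ ≤ λ₂`. -/
theorem sph_mono_of_one_le {l₁ l₂ : ℝ} (h1 : 1 ≤ l₁) (h : l₁ ≤ l₂) (g : SU11) :
    sph l₁ g ≤ sph l₂ g := by
  rw [sph_two_sub l₁, sph_two_sub l₂]
  exact sph_anti_of_le_one (by linarith) (by linarith) g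

/-- `λ ↦ sph λ g` is antitone on `(-∞, 1]`. -/
theorem antitoneOn_sph (g : SU11) : AntitoneOn (fun lam : ℝ => sph lam g) (Set.Iic 1) :=
  fun _ _ _ hb hab => sph_anti_of_le_one hab hb g

/-- `λ ↦ sph λ g` is monotone on `[1, ∞)`. -/
theorem monotoneOn_sph (g : SU11) : MonotoneOn (fun lam : ℝ => sph lam g) (Set.Ici 1) :=
  fun _ ha _ _ hab => sph_mono_of_one_le ha hab g

/-- `sph λ g = sph (1 - |λ - 1|) g`: the spherical functions are functions of `|λ - 1|`. -/
theorem sph_eq_sph_one_sub_abs (lam : ℝ) (g : SU11) : sph lam g = sph (1 - |lam - 1|) g := by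
  rcases le_or_gt lam 1 with h | h
  · rw [abs_of_nonpos (by linarith)]
    congr 1
    ring
  · rw [abs_of_pos (by linarith), sph_two_sub lam]
    congr 1
    ring

/-- **`|λ - 1| ≤ |λ' - 1| → sph λ g ≤ sph λ' g`**: non-decreasing in the distance to the critical
parameter. -/
theorem sph_le_of_abs_sub_one_le {lam lam' : ℝ} (h : |lam - 1| ≤ |lam' - 1|) (g : SU11) :
    sph lam g ≤ sph lam' g := by
  rw [sph_eq_sph_one_sub_abs lam, sph_eq_sph_one_sub_abs lam']
  exact sph_anti_of_le_one (by linarith) (by linarith [abs_nonneg (lam - 1)]) g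

end measure

end Summit.Ventures.HodgeRepro2.T5SU11SphericalLogConvex
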